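import Summits.AtomisticToContinuum.BoseEinsteinCondensation.Theorems.BECHardSphereReductionHardSphereBECPerRatioReductions
import Summits.AtomisticToContinuum.BoseEinsteinCondensation.Theorems.BECHardSphereReductionHardSphereBECStubSmallRatioMulOf
import HarnessLib

/-!
# Route BECHardSphereReduction — per-ratio dilute condensate RETENTION suffices for the crux
# (crux `HardSphereBEC`, stmt-AtomisticToContinuum-11885, line `registered`, skeleton v3; supports 11886)

Sequel of `Theorems/BECHardSphereReductionHardSphereBECPerRatioReductions.lean` (p156356).  Write
`cn(N, L) := condensateNumber HS₁ N L`.  The monotone input of the crux line is weakened once more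
(lead c6, 2026-08-17): instead of per-ratio box MONOTONICITY (`cn(N,L) ≤ cn(N,L/a)`) it suffices to
have per-ratio RETENTION UP TO A CONSTANT FACTOR, EVENTUALLY IN `N` — for the ratios `a` of some
open interval `(lo,hi) ⊂ (0,1)`, thresholds `N₀(a)`, guards `η₀(a) > 0` and factors `K(a) > 0`
with `cn(N, L) ≤ K(a) · cn(N, L/a)` for `N ≥ N₀(a)`, `N ≤ η₀(a) L³` (the registered stub
`stub_perRatioRetention` of `Lines/birth.lean`).  It asks for no sign (monotonicity), no
uniformity in the ratio and nothing about small `N`, so it is insensitive to the sign of the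
subleading finite-size corrections at the few-body → GP → thermodynamic crossovers that are the
recorded failure mode of crux #4 `HardSphereBoxMonotone`; it is implied by per-ratio box
monotonicity (`K = 1`, `N₀ = 0`), hence by items 11886 and 11884.

* `perRatioRetention_of_perRatioBoxMonotone`, `…_of_hardSphereBoxMonotone` (11886),
  `…_of_hardCoreDominates` (11884 at `v := HS_a`);
* `smallRatioRetention_of_perRatioRetention` — uniformity in the ratio is again free: the Baire
  uniformisation with constants and thresholds `Birth.stub_smallRatioMul_of` (p157014) fed with
  `Birth.stub_oneSidedBaire` (p153883) and left lower-semicontinuity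
  (`Birth.stub_leftLowerSemicontinuous_of Birth.stub_diamRightContinuity`, p155976 ∘ p155143);
* `intervalPropagation_of_smallRatioRetention` / `…_of_perRatioRetention` — BEC of unit hard
  spheres at one small reduced density propagates to an initial interval of densities (constant
  `c/K(a)` at `η' = a³η`);
* `hardSphereBEC_body_of_infraredBound_of_perRatioRetention` — the crux body from the sparse
  infrared bound (11888 weakened; the open kernel) and per-ratio retention alone.
-/

noncomputable section

namespace Summit.AtomisticToContinuum.BoseEinsteinCondensation.Cruxes.HardSphereBEC

open MeasureTheory ENNReal Filter Literature.MathematicalPhysics.QuantumManyBody.BoseGas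
open Summit.AtomisticToContinuum.BoseEinsteinCondensation.Theses.BECHardSphereReduction
open Summit.AtomisticToContinuum.BoseEinsteinCondensation.Theorems

/-! ## Per-ratio retention from the existing items -/

/-- **Per-ratio box monotonicity gives per-ratio retention** (`K := 1`, `N₀ := 0`). [folklore] -/
theorem perRatioRetention_of_perRatioBoxMonotone
    (h : ∃ lo hi : ℝ, 0 < lo ∧ lo < hi ∧ hi < 1 ∧ ∀ a : ℝ, lo < a → a < hi → ∃ η₀ : ℝ, 0 < η₀ ∧ ∀ (N : ℕ) (L : ℝ), (N : ℝ) ≤ η₀ * L ^ 3 → Literature.MathematicalPhysics.QuantumManyBody.BoseGas.condensateNumber (Set.indicator (Set.Iic 1) (fun _ : ℝ => (⊤ : ENNReal))) N L ≤ Literature.MathematicalPhysics.QuantumManyBody.BoseGas.condensateNumber (Set.indicator (Set.Iic 1) (fun _ : ℝ => (⊤ : ENNReal))) N (L / a)) :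
    ∃ lo hi : ℝ, 0 < lo ∧ lo < hi ∧ hi < 1 ∧ ∀ a : ℝ, lo < a → a < hi → ∃ (N₀ : ℕ) (η₀ K : ℝ), 0 < η₀ ∧ 0 < K ∧ ∀ (N : ℕ) (L : ℝ), N₀ ≤ N → (N : ℝ) ≤ η₀ * L ^ 3 → Literature.MathematicalPhysics.QuantumManyBody.BoseGas.condensateNumber (Set.indicator (Set.Iic 1) (fun _ : ℝ => (⊤ : ENNReal))) N L ≤ ENNReal.ofReal K * Literature.MathematicalPhysics.QuantumManyBody.BoseGas.condensateNumber (Set.indicator (Set.Iic 1) (fun _ : ℝ => (⊤ : ENNReal))) N (L / a) := by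
  obtain ⟨lo, hi, hlo, hlohi, hhi, hper⟩ := h
  refine ⟨lo, hi, hlo, hlohi, hhi, fun a hloa hahi => ?_⟩
  obtain ⟨η₀, hη₀, hmono⟩ := hper a hloa hahi
  refine ⟨0, η₀, 1, hη₀, one_pos, fun N L _ hNL => ?_⟩
  rw [ENNReal.ofReal_one, one_mul]
  exact hmono N L hNL

/-- **Item 11886 gives per-ratio retention** (via `perRatioBoxMonotone_of_hardSphereBoxMonotone`).
[folklore] -/
theorem perRatioRetention_of_hardSphereBoxMonotone (h : HardSphereBoxMonotone) :
    ∃ lo hi : ℝ, 0 < lo ∧ lo < hi ∧ hi < 1 ∧ ∀ a : ℝ, lo < a → a < hi → ∃ (N₀ : ℕ) (η₀ K : ℝ), 0 < η₀ ∧ 0 < K ∧ ∀ (N : ℕ) (L : ℝ), N₀ ≤ N → (N : ℝ) ≤ η₀ * L ^ 3 → Literature.MathematicalPhysics.QuantumManyBody.BoseGas.condensateNumber (Set.indicator (Set.Iic 1) (fun _ : ℝ => (⊤ : ENNReal))) N L ≤ ENNReal.ofReal K * Literature.MathematicalPhysics.QuantumManyBody.BoseGas.condensateNumber (Set.indicator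 (Set.Iic 1) (fun _ : ℝ => (⊤ : ENNReal))) N (L / a) :=
  perRatioRetention_of_perRatioBoxMonotone (perRatioBoxMonotone_of_hardSphereBoxMonotone h)

/-- **Item 11884 gives per-ratio retention** (via `perRatioBoxMonotone_of_hardCoreDominates`).
[folklore] -/
theorem perRatioRetention_of_hardCoreDominates (h : HardCoreDominates) :
    ∃ lo hi : ℝ, 0 < lo ∧ lo < hi ∧ hi < 1 ∧ ∀ a : ℝ, lo < a → a < hi → ∃ (N₀ : ℕ) (η₀ K : ℝ), 0 < η₀ ∧ 0 < K ∧ ∀ (N : ℕ) (L : ℝ), N₀ ≤ N → (N : ℝ) ≤ η₀ * L ^ 3 → Literature.MathematicalPhysics.QuantumManyBody.BoseGas.condensateNumber (Set.indicator (Set.Iic 1) (fun _ : ℝ => (⊤ : ENNReal))) N L ≤ ENNReal.ofReal K * Literature.MathematicalPhysics.QuantumManyBody.BoseGas.condensateNumber (Set.indicator (Set.Iic 1) (fun _ : ℝ => (⊤ : ENNReal))) N (L / a) :=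
  perRatioRetention_of_perRatioBoxMonotone (perRatioBoxMonotone_of_hardCoreDominates h)

/-! ## Uniformity in the ratio is free (with constants and thresholds) -/

/-- **Uniform small-ratio retention from per-ratio retention**: `Birth.stub_smallRatioMul_of`
applied to the landed one-sided Baire lemma and left lower-semicontinuity. [folklore] -/
theorem smallRatioRetention_of_perRatioRetention
    (h : ∃ lo hi : ℝ, 0 < lo ∧ lo < hi ∧ hi < 1 ∧ ∀ a : ℝ, lo < a → a < hi → ∃ (N₀ : ℕ) (η₀ K : ℝ), 0 < η₀ ∧ 0 < K ∧ ∀ (N : ℕ) (L : ℝ), N₀ ≤ N → (N : ℝ) ≤ η₀ * L ^ 3 → Literature.MathematicalPhysics.QuantumManyBody.BoseGas.condensateNumber (Set.indicator (Set.Iic 1) (fun _ : ℝ => (⊤ : ENNReal))) N L ≤ ENNReal.ofReal K * Literature.MathematicalPhysics.QuantumManyBody.BoseGas.condensateNumber (Set.indicator (Set.Iic 1) (fun _ : ℝ => (⊤ : ENNReal))) N (L / a)) :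
    ∃ (n : ℕ) (a₀ : ℝ), 0 < a₀ ∧ ∀ a : ℝ, 0 < a → a ≤ a₀ → ∃ K : ℝ, 0 < K ∧ ∀ (N : ℕ) (M : ℝ), n ≤ N → ((n : ℝ) + 1) * N < (a * M) ^ 3 → Literature.MathematicalPhysics.QuantumManyBody.BoseGas.condensateNumber (Set.indicator (Set.Iic 1) (fun _ : ℝ => (⊤ : ENNReal))) N (a * M) ≤ ENNReal.ofReal K * Literature.MathematicalPhysics.QuantumManyBody.BoseGas.condensateNumber (Set.indicator (Set.Iic 1) (fun _ : ℝ => (⊤ : ENNReal))) N M :=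
  Birth.stub_smallRatioMul_of Birth.stub_oneSidedBaire
    (Birth.stub_leftLowerSemicontinuous_of Birth.stub_diamRightContinuity) h

/-! ## Interval propagation of ground-state BEC in the density -/

/-- **Interval propagation from uniform small-ratio retention**: if for some `n` and `a₀ > 0`
every ratio `a ∈ (0, a₀]` has a factor `K(a) > 0` with `cn(HS₁, N, aM) ≤ K(a)·cn(HS₁, N, M)`
whenever `N ≥ n` and `(n+1)N < (aM)³`, then below `η₀ := 1/(2(n+1))` ground-state BEC of unit
hard spheres at ONE reduced density `η` (constant `c`) gives it on the whole initial interval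
`(0, a₀³ η]` (constant `c/K(a)`, `a = (η'/η)^{1/3}`): along `L_N(η) = a · L_N(η')` the guard
`(n+1)N < L_N(η)³ = N/η` is `η < 1/(n+1)` for `N ≥ 1`. [folklore] -/
theorem intervalPropagation_of_smallRatioRetention
    (h : ∃ (n : ℕ) (a₀ : ℝ), 0 < a₀ ∧ ∀ a : ℝ, 0 < a → a ≤ a₀ → ∃ K : ℝ, 0 < K ∧ ∀ (N : ℕ) (M : ℝ), n ≤ N → ((n : ℝ) + 1) * N < (a * M) ^ 3 → Literature.MathematicalPhysics.QuantumManyBody.BoseGas.condensateNumber (Set.indicator (Set.Iic 1) (fun _ : ℝ => (⊤ : ENNReal))) N (a * M) ≤ ENNReal.ofReal K * Literature.MathematicalPhysics.QuantumManyBody.BoseGas.condensateNumber (Set.indicator (Set.Iic 1) (fun _ : ℝ => (⊤ : ENNReal))) N M) :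
    ∃ η₀ : ℝ, 0 < η₀ ∧ ∀ η : ℝ, 0 < η → η ≤ η₀ →
      HasGroundStateBEC (Set.indicator (Set.Iic 1) (fun _ : ℝ => (⊤ : ENNReal))) η →
      ∃ η₁ : ℝ, 0 < η₁ ∧ ∀ η' : ℝ, 0 < η' → η' ≤ η₁ →
        HasGroundStateBEC (Set.indicator (Set.Iic 1) (fun _ : ℝ => (⊤ : ENNReal))) η' := by
  obtain ⟨n, a₀, ha₀, hmono⟩ := h
  have hn1 : (0 : ℝ) < (n : ℝ) + 1 := by positivity
  refine ⟨1 / (2 * ((n : ℝ) + 1)), by positivity, fun η hη hηle hBEC => ?_⟩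
  obtain ⟨c, hc, hev⟩ := hBEC
  refine ⟨a₀ ^ 3 * η, by positivity, fun η' hη' hη'le => ?_⟩
  -- the ratio `a := (η'/η)^{1/3} ∈ (0, a₀]` with `a³ = η'/η`
  set a : ℝ := (η' / η) ^ (1 / 3 : ℝ) with ha_def
  have hq : 0 < η' / η := div_pos hη' hη
  have ha : 0 < a := Real.rpow_pos_of_pos hq _
  have ha3 : a ^ 3 = η' / η := by
    rw [ha_def, ← Real.rpow_natCast, ← Real.rpow_mul hq.le]
    norm_num
  have hale : a ≤ a₀ := by
    have h1 : η' / η ≤ a₀ ^ 3 := by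
      rw [div_le_iff₀ hη]; exact hη'le
    have h2 : a ≤ (a₀ ^ 3) ^ (1 / 3 : ℝ) := Real.rpow_le_rpow hq.le h1 (by norm_num)
    rwa [← Real.rpow_natCast, ← Real.rpow_mul ha₀.le, show ((3 : ℕ) : ℝ) * (1 / 3 : ℝ) = 1 by
      norm_num, Real.rpow_one] at h2
  obtain ⟨K, hK, hmul⟩ := hmono a ha hale
  refine ⟨c / K, div_pos hc hK, ?_⟩
  -- `L_N(η) = a · L_N(η')`
  have hside : ∀ N : ℕ, sideLength η N = a * sideLength η' N := by
    intro N
    have hηa : η = η' * (a⁻¹) ^ 3 := by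
      rw [inv_pow, ha3]; field_simp
    rw [hηa, sideLength_mul_pow_three hη' (inv_pos.2 ha) N, div_eq_mul_inv, inv_inv, mul_comm]
  filter_upwards [hev, eventually_gt_atTop 0, eventually_ge_atTop n] with N hN hNpos hNn
  have hguard : ((n : ℝ) + 1) * N < (a * sideLength η' N) ^ 3 := by
    rw [← hside N, Cruxes.HardSphereBEC.sideLength_pow_three hη N, lt_div_iff₀ hη]
    have hNr : (0 : ℝ) < N := Nat.cast_pos.2 hNpos
    have hη2 : η * (2 * ((n : ℝ) + 1)) ≤ 1 := by
      rwa [le_div_iff₀ (by positivity)] at hηle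
    nlinarith
  have hchain : ENNReal.ofReal (c * N) ≤ ENNReal.ofReal K *
      condensateNumber (Set.indicator (Set.Iic 1) (fun _ : ℝ => (⊤ : ENNReal))) N
        (sideLength η' N) :=
    calc ENNReal.ofReal (c * N)
        ≤ condensateNumber (Set.indicator (Set.Iic 1) (fun _ : ℝ => (⊤ : ENNReal))) N
            (sideLength η N) := hN
      _ = condensateNumber (Set.indicator (Set.Iic 1) (fun _ : ℝ => (⊤ : ENNReal))) N
            (a * sideLength η' N) := by rw [hside N]
      _ ≤ ENNReal.ofReal K *
            condensateNumber (Set.indicator (Set.Iic 1) (fun _ : ℝ => (⊤ : ENNReal))) N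
              (sideLength η' N) := hmul N _ hNn hguard
  have hcast : c / K * (N : ℝ) = c * N / K := by ring
  rw [hcast, ENNReal.ofReal_div_of_pos hK]
  exact ENNReal.div_le_of_le_mul' hchain

/-- **Interval propagation from per-ratio retention** (`smallRatioRetention_of_perRatioRetention`
+ `intervalPropagation_of_smallRatioRetention`). [folklore] -/
theorem intervalPropagation_of_perRatioRetention
    (h : ∃ lo hi : ℝ, 0 < lo ∧ lo < hi ∧ hi < 1 ∧ ∀ a : ℝ, lo < a → a < hi → ∃ (N₀ : ℕ) (η₀ K : ℝ), 0 < η₀ ∧ 0 < K ∧ ∀ (N : ℕ) (L : ℝ), N₀ ≤ N → (N : ℝ) ≤ η₀ * L ^ 3 → Literature.MathematicalPhysics.QuantumManyBody.BoseGas.condensateNumber (Set.indicator (Set.Iic 1) (fun _ : ℝ => (⊤ : ENNReal))) N L ≤ ENNReal.ofReal K * Literature.MathematicalPhysics.QuantumManyBody.BoseGas.condensateNumber (Set.indicator (Set.Iic 1) (fun _ : ℝ => (⊤ : ENNReal))) N (L / a)) :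
    ∃ η₀ : ℝ, 0 < η₀ ∧ ∀ η : ℝ, 0 < η → η ≤ η₀ →
      HasGroundStateBEC (Set.indicator (Set.Iic 1) (fun _ : ℝ => (⊤ : ENNReal))) η →
      ∃ η₁ : ℝ, 0 < η₁ ∧ ∀ η' : ℝ, 0 < η' → η' ≤ η₁ →
        HasGroundStateBEC (Set.indicator (Set.Iic 1) (fun _ : ℝ => (⊤ : ENNReal))) η' :=
  intervalPropagation_of_smallRatioRetention (smallRatioRetention_of_perRatioRetention h)

/-! ## The crux body from the two open inputs of the line (skeleton v3) -/

/-- **The crux body from the sparse infrared bound and per-ratio retention**: per-ratio retention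
gives interval propagation below a threshold `η₀` (`intervalPropagation_of_perRatioRetention`);
the sparse infrared bound at that threshold gives one density `η ≤ η₀` with zero-mode BEC
(`sparseZeroMode_of_infraredBound`, `hasGroundStateBEC_of_zeroMode'`); propagation fills
`(0, η₁]`; for diameter `a` take `ρ₀ := η₁/a³` and transport by scaling
(`hasGroundStateBEC_hardSphere_of_unit'`).  Conclusion = the body of the route decl `HardSphereBEC`,
verbatim. [folklore] -/
theorem hardSphereBEC_body_of_infraredBound_of_perRatioRetention
    (h1 : ∀ η₀ : ℝ, 0 < η₀ → ∃ η : ℝ, 0 < η ∧ η ≤ η₀ ∧ ∃ c : ℝ, 0 < c ∧ ∀ᶠ N : ℕ in Filter.atTop, ∃ δ : ENNReal, 0 < δ ∧ ∀ Ψ : Literature.MathematicalPhysics.QuantumManyBody.BoseGas.TrialState N (Literature.MathematicalPhysics.QuantumManyBody.BoseGas.sideLength η N), Literature.MathematicalPhysics.QuantumManyBody.BoseGas.energy (Set.indicator (Set.Iic 1) (fun _ : ℝ => (⊤ : ENNReal))) Ψ ≤ Literature.MathematicalPhysics.QuantumManyBody.BoseGas.groundStateEnergy (Set.indicator (Set.Iic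 1) (fun _ : ℝ => (⊤ : ENNReal))) N (Literature.MathematicalPhysics.QuantumManyBody.BoseGas.sideLength η N) + δ → Literature.MathematicalPhysics.QuantumManyBody.NeumannBox.nPlusLow (Real.sqrt (32 * Real.pi * η / c) * Literature.MathematicalPhysics.QuantumManyBody.BoseGas.sideLength η N) (Literature.MathematicalPhysics.QuantumManyBody.BoseGas.sideLength η N) N Ψ.ψ + ENNReal.ofReal (2 * c * N) ≤ (N : ENNReal))
    (h2 : ∃ lo hi : ℝ, 0 < lo ∧ lo < hi ∧ hi < 1 ∧ ∀ a : ℝ, lo < a → a < hi → ∃ (N₀ : ℕ) (η₀ K : ℝ), 0 < η₀ ∧ 0 < K ∧ ∀ (N : ℕ) (L : ℝ), N₀ ≤ N → (N : ℝ) ≤ η₀ * L ^ 3 → Literature.MathematicalPhysics.QuantumManyBody.BoseGas.condensateNumber (Set.indicator (Set.Iic 1) (fun _ : ℝ => (⊤ : ENNReal))) N L ≤ ENNReal.ofReal K * Literature.MathematicalPhysics.QuantumManyBody.BoseGas.condensateNumber (Set.indicator (Set.Iic 1) (fun _ : ℝ => (⊤ : ENNReal))) N (L / a)) :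
    ∀ a : ℝ, 0 < a → ∃ ρ₀ : ℝ, 0 < ρ₀ ∧ ∀ ρ : ℝ, 0 < ρ → ρ < ρ₀ → Literature.MathematicalPhysics.QuantumManyBody.BoseGas.HasGroundStateBEC (Set.indicator (Set.Iic a) (fun _ : ℝ => (⊤ : ENNReal))) ρ := by
  intro a ha
  obtain ⟨η₀, hη₀, hprop⟩ := intervalPropagation_of_perRatioRetention h2
  obtain ⟨η, hη, hηle, c, hc, hev⟩ := sparseZeroMode_of_infraredBound h1 η₀ hη₀
  have hBEC : HasGroundStateBEC (Set.indicator (Set.Iic 1) (fun _ : ℝ => (⊤ : ENNReal))) η :=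
    hasGroundStateBEC_of_zeroMode' hη hc hev
  obtain ⟨η₁, hη₁, hall⟩ := hprop η hη hηle hBEC
  have ha3 : 0 < a ^ 3 := pow_pos ha 3
  refine ⟨η₁ / a ^ 3, div_pos hη₁ ha3, fun ρ hρ hρlt => ?_⟩
  have hρa : 0 < ρ * a ^ 3 := mul_pos hρ ha3
  have hρalt : ρ * a ^ 3 < η₁ := (lt_div_iff₀ ha3).1 hρlt
  exact hasGroundStateBEC_hardSphere_of_unit' ha hρ (hall (ρ * a ^ 3) hρa hρalt.le)

end Summit.AtomisticToContinuum.BoseEinsteinCondensation.Cruxes.HardSphereBEC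

end
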